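import Summits.AtomisticToContinuum.HydrodynamicLimit.Theorems.CollisionIsometryCLTMacroClosureTwoScaleDefs
import Summits.AtomisticToContinuum.HydrodynamicLimit.Theorems.CollisionIsometryCLTMacroClosureStubBalanceB3
import HarnessLib

/-!
# Occupation floor and ceiling of the cubes from the fine a-priori band (input of `stub_blockMGF_twoScale`,
line `IdeatorTwoGen1Sketch`, crux `MacroClosure`, stmt-AtomisticToContinuum-14870)

Proof file (`--supports stmt-AtomisticToContinuum-14870`) for the registered stub `Barycentric.stub_twoScale_occupation`.

With `ψ = Torus.kernel r` the torus mollifier of radius `r` (`0 < r`, `2r ≤ ℓ`, `ℓ + 2r ≤ 1/2`) and a configuration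
`z` of `N + 1` spheres all of whose `ψ`-blocks have density in the band `[c₂, σ⁻³]`, every half-open cube of side
`ℓ` (lower corner `x`, read in the fundamental-domain coordinates `Torus.repr`) contains at least
`κ₀ c₂ (N+1) r³` and at most `(N+1) σ⁻³ (ℓ + 2r)³` particles, `κ₀ = 1 / max (sup ρ₁) 1` (`ρ₁` the fixed profile):

* FLOOR — the band at the cube centre `x_c = x + (ℓ/2)𝟙` gives `c₂ (N+1) ≤ Σᵢ ψ(qᵢ − x_c)`; a non-zero term has
  `‖qᵢ − x_c‖ < r ≤ ℓ/2` (sup norm), hence `qᵢ` lies in the cube, and each term is `≤ sup ρ₁ · r⁻³`;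
* CEILING — `#cell = Σ_{i ∈ cell} ∫ ψ(qᵢ − y) dy` (unit mass, translation/negation invariance of Haar measure); the
  integrand is `≤ Σ_all ψ(qᵢ − y) = (N+1) ρ̄(y) ≤ (N+1) σ⁻³` and vanishes unless every coordinate of
  `repr (y − x + r𝟙)` is `< ℓ + 2r`, a set of Haar volume `≤ (ℓ + 2r)³` (`Torus.measurePreserving_repr`).
-/

noncomputable section

open MeasureTheory Filter Set Topology InformationTheory
open scoped ENNReal ContDiff Convolution

namespace Summit.AtomisticToContinuum.HydrodynamicLimit.Theorems.MacroClosureLine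

open Literature.MathematicalPhysics.KineticTheory Literature.Analysis.FluidPDE
open Literature.Analysis.FunctionSpaces

namespace Barycentric

namespace TwoScaleOccupation

variable {N : ℕ}

/-! ## Coordinates on `𝕋³ = (ℝ/ℤ)³` -/

/-- Every coordinate of a point of `𝕋³` is the class of a real number realising its quotient norm
(the symmetric representative `Torus.reprSym`). -/
theorem exists_coe_eq_abs_eq (w : T3) (l : Fin 3) :
    ∃ t : ℝ, ((t : ℝ) : UnitAddCircle) = w l ∧ |t| = ‖w l‖ :=
  ⟨Torus.reprSym w l, by rw [Torus.reprSym_apply]; exact AddCircle.coe_equivIoc,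
    Torus.abs_reprSym_apply w l⟩

/-- If the `l`-th coordinate of `y ∈ 𝕋³` is the class of a real `s ∈ [0, 1)`, then its fundamental-domain
coordinate is `repr y l = s`. -/
theorem repr_apply_eq_of_mem_Ico {y : T3} {l : Fin 3} {s : ℝ} (hs : s ∈ Ico (0 : ℝ) 1)
    (hy : y l = ((s : ℝ) : UnitAddCircle)) : Torus.repr y l = s := by
  have hs' : s ∈ Ico (0 : ℝ) (0 + 1) := by simpa only [zero_add] using hs
  rw [Torus.repr_apply, hy, AddCircle.equivIco_coe_eq hs']

/-- FLOOR GEOMETRY: a point within sup-distance `r ≤ ℓ/2` of the centre `x + (ℓ/2)𝟙` of the cube of side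
`ℓ ≤ 1` with lower corner `x` lies in that (half-open) cube. -/
theorem inCube_of_norm_sub_centre_lt {ℓ r : ℝ} (hrℓ : r ≤ ℓ / 2) (hℓ : ℓ ≤ 1) {x q : T3}
    (hq : ‖q - (x + fun _ : Fin 3 => (((ℓ / 2 : ℝ)) : UnitAddCircle))‖ < r) : inCube ℓ (q - x) := by
  intro l
  obtain ⟨t, ht, habs⟩ :=
    exists_coe_eq_abs_eq (q - (x + fun _ : Fin 3 => (((ℓ / 2 : ℝ)) : UnitAddCircle))) l
  have htl : |t| < r := by
    rw [habs]
    exact (norm_le_pi_norm (q - (x + fun _ : Fin 3 => (((ℓ / 2 : ℝ)) : UnitAddCircle))) l).trans_lt hq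
  have ht1 : -r < t := (abs_lt.1 htl).1
  have ht2 : t < r := (abs_lt.1 htl).2
  have hmem : t + ℓ / 2 ∈ Ico (0 : ℝ) 1 := ⟨by linarith, by linarith⟩
  have hcoord : (q - x) l = (((t + ℓ / 2 : ℝ)) : UnitAddCircle) := by
    have h : q - x = (q - (x + fun _ : Fin 3 => (((ℓ / 2 : ℝ)) : UnitAddCircle))) +
        fun _ : Fin 3 => (((ℓ / 2 : ℝ)) : UnitAddCircle) := by abel
    rw [h, Pi.add_apply, ← ht, AddCircle.coe_add]
  rw [repr_apply_eq_of_mem_Ico hmem hcoord]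
  linarith

/-- CEILING GEOMETRY: if `q` lies in the cube of side `ℓ` with lower corner `x` and `y` is within sup-distance
`r` of `q`, `ℓ + 2r ≤ 1`, then every fundamental-domain coordinate of `y - x + r𝟙` is `< ℓ + 2r`. -/
theorem repr_lt_of_inCube_of_norm_sub_lt {ℓ r : ℝ} (hL : ℓ + 2 * r ≤ 1) {x q y : T3}
    (hq : inCube ℓ (q - x)) (hy : ‖q - y‖ < r) (l : Fin 3) :
    Torus.repr (y - x + fun _ : Fin 3 => (((r : ℝ)) : UnitAddCircle)) l < ℓ + 2 * r := by
  obtain ⟨t, ht, habs⟩ := exists_coe_eq_abs_eq (q - y) l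
  have htl : |t| < r := by
    rw [habs]
    exact (norm_le_pi_norm (q - y) l).trans_lt hy
  have ht1 : -r < t := (abs_lt.1 htl).1
  have ht2 : t < r := (abs_lt.1 htl).2
  have ha : Torus.repr (q - x) l ∈ Ico (0 : ℝ) 1 := Torus.repr_apply_mem_Ico (q - x) l
  have haℓ : Torus.repr (q - x) l < ℓ := hq l
  have hmem : Torus.repr (q - x) l - t + r ∈ Ico (0 : ℝ) 1 := ⟨by linarith [ha.1], by linarith⟩
  have hcoord : (y - x + fun _ : Fin 3 => (((r : ℝ)) : UnitAddCircle)) l =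
      (((Torus.repr (q - x) l - t + r : ℝ)) : UnitAddCircle) := by
    have hqx : (q - x) l = (((Torus.repr (q - x) l : ℝ)) : UnitAddCircle) := by
      rw [Torus.repr_apply]
      exact AddCircle.coe_equivIco.symm
    have h : (y - x + fun _ : Fin 3 => (((r : ℝ)) : UnitAddCircle)) =
        (q - x) - (q - y) + fun _ : Fin 3 => (((r : ℝ)) : UnitAddCircle) := by abel
    rw [h, Pi.add_apply, Pi.sub_apply, hqx, ← ht, AddCircle.coe_add, AddCircle.coe_sub]
  rw [repr_apply_eq_of_mem_Ico hmem hcoord]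
  linarith

/-- Haar volume of the box `{y | ∀ l, repr (y - x + c) l < L}` is at most `L³` (`0 ≤ L`): translate, push forward
along the measure-preserving section `repr : 𝕋³ → [0,1)³`, and compute the Lebesgue volume of `[0, L)³`. -/
theorem volume_box_le {L : ℝ} (hL0 : 0 ≤ L) (x c : T3) :
    volume {y : T3 | ∀ l, Torus.repr (y - x + c) l < L} ≤ ENNReal.ofReal (L ^ 3) := by
  set B : Set (EuclideanSpace ℝ (Fin 3)) := {v | ∀ l, v l < L} with hB
  have hE : {y : T3 | ∀ l, Torus.repr (y - x + c) l < L} =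
      (fun y => y + (-x + c)) ⁻¹' (Torus.repr ⁻¹' B) := by
    ext y
    simp only [hB, mem_setOf_eq, mem_preimage, sub_eq_add_neg, add_assoc]
  rw [hE, measure_preimage_add_right]
  calc volume (Torus.repr ⁻¹' B)
      ≤ volume.map Torus.repr B := Measure.le_map_apply Torus.measurable_repr.aemeasurable B
    _ = volume (B ∩ Torus.unitCube (Fin 3)) := by
        rw [(Torus.measurePreserving_repr (d := Fin 3)).map_eq,
          Measure.restrict_apply' Torus.measurableSet_unitCube]
    _ ≤ volume ((WithLp.ofLp : EuclideanSpace ℝ (Fin 3) → Fin 3 → ℝ) ⁻¹'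
          Set.pi univ fun _ => Ico (0 : ℝ) L) := by
        refine measure_mono fun v hv => ?_
        rw [mem_inter_iff, hB, mem_setOf_eq, Torus.mem_unitCube] at hv
        rw [mem_preimage, mem_univ_pi]
        exact fun i => ⟨(hv.2 i).1, hv.1 i⟩
    _ = volume (Set.pi univ fun _ : Fin 3 => Ico (0 : ℝ) L) :=
        (PiLp.volume_preserving_ofLp (Fin 3)).measure_preimage
          (MeasurableSet.univ_pi fun _ => measurableSet_Ico).nullMeasurableSet
    _ = ENNReal.ofReal (L ^ 3) := by
        rw [volume_pi_pi]
        simp only [Real.volume_Ico, sub_zero, Finset.prod_const, Finset.card_univ, Fintype.card_fin]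
        rw [← ENNReal.ofReal_pow hL0]

/-! ## The mollifier -/

/-- Off the sup-ball of radius `r` the mollifier vanishes, so a non-zero value forces `‖y‖ < r`. -/
theorem norm_lt_of_kernel_ne_zero {r : ℝ} (hr : 0 < r) {y : T3} (h : Torus.kernel r y ≠ 0) : ‖y‖ < r :=
  not_le.1 fun h' => h (Torus.kernel_eq_zero_of_le hr h')

/-- Sup bound of the torus mollifier: `kernel r y ≤ K r⁻³` for any bound `K` of the fixed profile `ρ₁`. -/
theorem kernel_le {K r : ℝ} (hK : ∀ v, ‖Torus.profileOne (Fin 3) v‖ ≤ K) (hr : 0 < r) (y : T3) :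
    Torus.kernel r y ≤ K * (r ^ 3)⁻¹ := by
  show Torus.transplant (Torus.profile r) y ≤ _
  rw [Torus.transplant_apply]
  simp only [Torus.profile, Fintype.card_fin]
  rw [mul_comm]
  exact mul_le_mul_of_nonneg_right ((Real.le_norm_self _).trans (hK _)) (inv_nonneg.2 (pow_pos hr 3).le)

/-! ## Floor and ceiling -/

/-- **Occupation floor.** If all `ψ`-blocks have density `≥ c₂` then every cube of side `ℓ ≥ 2r` holds at least
`c₂ (N+1) r³ / K` particles, `K` any positive bound of the fixed profile. -/
theorem floor {K : ℝ} (hK : ∀ v, ‖Torus.profileOne (Fin 3) v‖ ≤ K) (hKpos : 0 < K) {ℓ r : ℝ} (hr : 0 < r)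
    (h2r : 2 * r ≤ ℓ) (hℓ1 : ℓ ≤ 1) {c₂ : ℝ} (z : Config (N + 1) (Fin 3) T3)
    (hband : ∀ x, c₂ ≤ bρ (Torus.kernel (d := Fin 3) r) z x) (x : T3) :
    K⁻¹ * c₂ * (((N : ℝ) + 1) * r ^ 3) ≤ (cellCount ℓ z x : ℝ) := by
  classical
  have hN : (0 : ℝ) < (N : ℝ) + 1 := by positivity
  have hb := hband (x + fun _ : Fin 3 => (((ℓ / 2 : ℝ)) : UnitAddCircle))
  rw [bρ_eq_sum] at hb
  push_cast at hb
  have hsum : ∑ i ∈ cellSet ℓ z x,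
      Torus.kernel r ((z i).1 - (x + fun _ : Fin 3 => (((ℓ / 2 : ℝ)) : UnitAddCircle))) =
      ∑ i, Torus.kernel r ((z i).1 - (x + fun _ : Fin 3 => (((ℓ / 2 : ℝ)) : UnitAddCircle))) :=
    Finset.sum_filter_of_ne fun i _ hi =>
      inCube_of_norm_sub_centre_lt (by linarith) hℓ1 (norm_lt_of_kernel_ne_zero hr hi)
  have hle : ∑ i ∈ cellSet ℓ z x,
      Torus.kernel r ((z i).1 - (x + fun _ : Fin 3 => (((ℓ / 2 : ℝ)) : UnitAddCircle))) ≤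
      (cellCount ℓ z x : ℝ) * (K * (r ^ 3)⁻¹) := by
    have h := Finset.sum_le_card_nsmul (cellSet ℓ z x)
      (fun i => Torus.kernel r ((z i).1 - (x + fun _ : Fin 3 => (((ℓ / 2 : ℝ)) : UnitAddCircle))))
      (K * (r ^ 3)⁻¹) (fun i _ => kernel_le hK hr _)
    rwa [nsmul_eq_mul] at h
  have hmain : ((N : ℝ) + 1) * c₂ ≤ (cellCount ℓ z x : ℝ) * (K * (r ^ 3)⁻¹) :=
    (((le_inv_mul_iff₀ hN).1 hb).trans_eq hsum.symm).trans hle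
  have hr3 : 0 < r ^ 3 := pow_pos hr 3
  calc K⁻¹ * c₂ * (((N : ℝ) + 1) * r ^ 3) = ((N : ℝ) + 1) * c₂ * (r ^ 3 * K⁻¹) := by ring
    _ ≤ (cellCount ℓ z x : ℝ) * (K * (r ^ 3)⁻¹) * (r ^ 3 * K⁻¹) :=
        mul_le_mul_of_nonneg_right hmain (by positivity)
    _ = (cellCount ℓ z x : ℝ) := by
        field_simp

/-- **Occupation ceiling.** If all `ψ`-blocks have density `≤ σ⁻³` then every cube of side `ℓ` holds at most
`(N+1) σ⁻³ (ℓ + 2r)³` particles (`ℓ + 2r ≤ 1/2`, `r ≤ 1/4`). -/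
theorem ceiling {ℓ r : ℝ} (hr : 0 < r) (hr4 : r ≤ 1 / 4) (hℓ0 : 0 ≤ ℓ) (hL : ℓ + 2 * r ≤ 1) {σ : ℝ}
    (hσ : 0 < σ) (z : Config (N + 1) (Fin 3) T3)
    (hband : ∀ x, bρ (Torus.kernel (d := Fin 3) r) z x * σ ^ 3 ≤ 1) (x : T3) :
    (cellCount ℓ z x : ℝ) * σ ^ 3 ≤ ((N : ℝ) + 1) * (ℓ + 2 * r) ^ 3 := by
  classical
  haveI : (volume : Measure T3).IsNegInvariant := Measure.IsAddHaarMeasure.isNegInvariant_of_regular _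
  have hN : (0 : ℝ) < (N : ℝ) + 1 := by positivity
  have hσ3 : 0 < σ ^ 3 := pow_pos hσ 3
  have hψc : Continuous (Torus.kernel (d := Fin 3) r) := Torus.continuous_kernel hr hr4
  -- unit mass of every translate
  have hone : ∀ q : T3, ∫ y, Torus.kernel r (q - y) = 1 := fun q => by
    rw [integral_sub_left_eq_self (Torus.kernel (d := Fin 3) r) volume q]
    exact Torus.integral_kernel hr hr4
  -- the cell count is the integral of the cell's kernel sum
  have hint : ∀ i ∈ cellSet ℓ z x, Integrable (fun y : T3 => Torus.kernel r ((z i).1 - y)) volume :=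
    fun i _ => (hψc.comp (continuous_const.sub continuous_id)).integrable_unitAddTorus
  have hcount : (cellCount ℓ z x : ℝ) = ∫ y, ∑ i ∈ cellSet ℓ z x, Torus.kernel r ((z i).1 - y) := by
    rw [integral_finsetSum (cellSet ℓ z x) hint]
    simp only [hone, Finset.sum_const, nsmul_eq_mul, mul_one]
    rfl
  -- pointwise ceiling of the integrand from the band
  have hFle : ∀ y, ∑ i ∈ cellSet ℓ z x, Torus.kernel r ((z i).1 - y) ≤ ((N : ℝ) + 1) * (σ ^ 3)⁻¹ := by
    intro y
    have h2 := hband y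
    rw [bρ_eq_sum] at h2
    push_cast at h2
    calc ∑ i ∈ cellSet ℓ z x, Torus.kernel r ((z i).1 - y) ≤ ∑ i, Torus.kernel r ((z i).1 - y) :=
          Finset.sum_le_sum_of_subset_of_nonneg (Finset.subset_univ _)
            fun i _ _ => Torus.kernel_nonneg hr.le _
      _ = ((N : ℝ) + 1)⁻¹ * (∑ i, Torus.kernel r ((z i).1 - y)) * σ ^ 3 *
            (((N : ℝ) + 1) * (σ ^ 3)⁻¹) := by
          field_simp
      _ ≤ 1 * (((N : ℝ) + 1) * (σ ^ 3)⁻¹) := mul_le_mul_of_nonneg_right h2 (by positivity)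
      _ = ((N : ℝ) + 1) * (σ ^ 3)⁻¹ := one_mul _
  have hF0 : ∀ y, 0 ≤ ∑ i ∈ cellSet ℓ z x, Torus.kernel r ((z i).1 - y) := fun y =>
    Finset.sum_nonneg fun i _ => Torus.kernel_nonneg hr.le _
  -- the integrand vanishes off the enlarged box `E`
  set E : Set T3 :=
    {y | ∀ l, Torus.repr (y - x + fun _ : Fin 3 => (((r : ℝ)) : UnitAddCircle)) l < ℓ + 2 * r} with hE
  have hFzero : ∀ y, y ∉ E → ∑ i ∈ cellSet ℓ z x, Torus.kernel r ((z i).1 - y) = 0 := by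
    intro y hy
    by_contra hne
    obtain ⟨i, hi, hine⟩ := Finset.exists_ne_zero_of_sum_ne_zero hne
    have hq : inCube ℓ ((z i).1 - x) := by
      simp only [cellSet, Finset.mem_filter, Finset.mem_univ, true_and] at hi
      exact hi
    exact hy fun l => repr_lt_of_inCube_of_norm_sub_lt hL hq (norm_lt_of_kernel_ne_zero hr hine) l
  have hvolE : volume E ≤ ENNReal.ofReal ((ℓ + 2 * r) ^ 3) := volume_box_le (by linarith) x _
  have hnorm : ∀ y ∈ E, ‖∑ i ∈ cellSet ℓ z x, Torus.kernel r ((z i).1 - y)‖ ≤ ((N : ℝ) + 1) * (σ ^ 3)⁻¹ :=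
    fun y _ => by
      rw [Real.norm_eq_abs, abs_of_nonneg (hF0 y)]
      exact hFle y
  have hint : ∫ y, ∑ i ∈ cellSet ℓ z x, Torus.kernel r ((z i).1 - y) ≤
      ((N : ℝ) + 1) * (σ ^ 3)⁻¹ * (ℓ + 2 * r) ^ 3 := by
    rw [← setIntegral_eq_integral_of_forall_compl_eq_zero hFzero]
    have h := norm_setIntegral_le_of_norm_le_const (measure_lt_top volume E) hnorm
    rw [measureReal_def] at h
    calc ∫ y in E, ∑ i ∈ cellSet ℓ z x, Torus.kernel r ((z i).1 - y)
        ≤ ‖∫ y in E, ∑ i ∈ cellSet ℓ z x, Torus.kernel r ((z i).1 - y)‖ := Real.le_norm_self _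
      _ ≤ ((N : ℝ) + 1) * (σ ^ 3)⁻¹ * (volume E).toReal := h
      _ ≤ ((N : ℝ) + 1) * (σ ^ 3)⁻¹ * (ℓ + 2 * r) ^ 3 :=
          mul_le_mul_of_nonneg_left (ENNReal.toReal_le_of_le_ofReal (by positivity) hvolE) (by positivity)
  rw [hcount]
  calc (∫ y, ∑ i ∈ cellSet ℓ z x, Torus.kernel r ((z i).1 - y)) * σ ^ 3
      ≤ ((N : ℝ) + 1) * (σ ^ 3)⁻¹ * (ℓ + 2 * r) ^ 3 * σ ^ 3 := mul_le_mul_of_nonneg_right hint hσ3.le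
    _ = ((N : ℝ) + 1) * (ℓ + 2 * r) ^ 3 := by
        field_simp

end TwoScaleOccupation

open TwoScaleOccupation in
/-- **Occupation floor and ceiling** of every cube of side `ℓ` from the a-priori band of the mollifier `Torus.kernel r`, `2r ≤ ℓ` (registered stub `stub_twoScale_occupation`). [folklore] -/
theorem stub_twoScale_occupation : ∃ κ₀ : ℝ, 0 < κ₀ ∧ ∀ (ℓ r : ℝ), 0 < r → 2 * r ≤ ℓ → ℓ + 2 * r ≤ 1 / 2 →
    ∀ (N : ℕ) (σ c₂ : ℝ), 0 < σ → ∀ (z : Config (N + 1) (Fin 3) T3),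
    (∀ x, c₂ ≤ bρ (Torus.kernel (d := Fin 3) r) z x ∧ bρ (Torus.kernel (d := Fin 3) r) z x * σ ^ 3 ≤ 1) →
    ∀ x : T3, κ₀ * c₂ * (((N : ℝ) + 1) * r ^ 3) ≤ (cellCount ℓ z x : ℝ) ∧
      (cellCount ℓ z x : ℝ) * σ ^ 3 ≤ ((N : ℝ) + 1) * (ℓ + 2 * r) ^ 3 := by
  obtain ⟨K0, hK0⟩ :=
    (Torus.contDiff_profileOne (d := Fin 3)).continuous.bounded_above_of_compact_support
      (Torus.hasCompactSupport_profileOne (d := Fin 3))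
  have hKpos : 0 < max K0 1 := lt_of_lt_of_le one_pos (le_max_right _ _)
  have hKb : ∀ v, ‖Torus.profileOne (Fin 3) v‖ ≤ max K0 1 := fun v => (hK0 v).trans (le_max_left _ _)
  refine ⟨(max K0 1)⁻¹, inv_pos.2 hKpos, ?_⟩
  intro ℓ r hr h2r hℓr N σ c₂ hσ z hband x
  exact ⟨floor hKb hKpos hr h2r (by linarith) z (fun y => (hband y).1) x,
    ceiling hr (by linarith) (by linarith) (by linarith) hσ z (fun y => (hband y).2) x⟩

end Barycentric

end Summit.AtomisticToContinuum.HydrodynamicLimit.Theorems.MacroClosureLine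

end
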